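import Summits.MatrixMultiplication.MatrixMultiplication.Theses.TetrahedronCarving
import Summits.MatrixMultiplication.MatrixMultiplication.Theorems.TetrahedronTensorGraphBridge
import Summits.MatrixMultiplication.MatrixMultiplication.Theorems.TetrahedronTensorRectangular
import Literature.Computability.AlgebraicComplexity.GraphTensorCliqueCut
import Literature.Computability.AlgebraicComplexity.GraphTensorCliqueCover
import Literature.Computability.AlgebraicComplexity.GraphTensorTriangle
import Literature.Computability.AlgebraicComplexity.Coppersmith1982RapidRectangular
import Literature.Computability.AlgebraicComplexity.RectangularExponentSubadditivity
import Literature.Computability.AlgebraicComplexity.RectangularExponentSymmetry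
import Literature.Computability.AlgebraicComplexity.RectangularExponentInformationBound
import HarnessLib

/-!
# TetraTwinCliqueLadder — the TRUE-TWIN CLIQUE LADDER through the attacked leaf `TetraExcessZero`:
`L(a) : ω(T(K_{a+2})) ≤ ω(1, a, a)` holds for `a = 0, 1`, IS the leaf at `a = 2`, is undecided (and not
NEC-certified) at `a = 3`, and is FALSE for every `a ≥ 4` over every field

(decomp-mm lens 6 «barrier-complement carving», generation 36; kernel `--supports` the attacked leaf
stmt-MatrixMultiplication-26697 `Theses.TetrahedronCarving.TetraExcessZero : ω(K₄) ≤ ω(2,1,2)`; the cut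
of record `closes (hA : TetraExcessZero) (hB : TetraPlusTwo)` is UNCHANGED.)

THE FAMILY. `K_{a+2}` is the triangle `K₃` with one vertex substituted by the clique `K_a` (its `a`
vertices are pairwise TRUE twins); the book `K_{1,1,a}` is `K₃` with the same vertex substituted by an
independent set (FALSE twins). The book's tensor is exactly priced: grouping the `a` twins shows
`T(K_{1,1,a})_n ≅ ⟨n^a, n^a, n⟩ ⊗ (nothing)`, exponent `ω(a, a, 1) = ω(1, a, a)` (the blow-up collapse of
g35, here only quoted as motivation — the statements below are about `ω(1,a,a)` itself). The rung
`L(a) : ω(T(K_{a+2})) ≤ ω(1, a, a)` says «the `binom(a,2)` clique-internal EPR pairs between the twins are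
absorbed at no cost in the exponent». At `a = 2` this is LITERALLY the attacked leaf: `T(K₄)` versus the
diamond `K₄ − e = K_{1,1,2}`, `ω(K₄) ≤ ω(2,1,2)` (`cliqueRung_two_iff_tetraExcessZero`).

WHAT THIS FILE PROVES (every field `F`, no named-fact hypothesis, no `sorry`, no new definition):
 * `a = 0, 1`: `L(0)`, `L(1)` hold with EQUALITY (`ω(T(K₂)) = 1 = ω(1,0,0)`, `ω(T(K₃)) = ω = ω(1,1,1)`).
 * `a = 2`: `L(2) ↔ ω(K₄) ≤ ω(2,1,2)` (`↔ TetraExcessZero` at `F = ℂ`), and the excess is `≥ 0`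
   (`ω(1,2,2) ≤ ω(T(K₄))`, grouping); NEC: `ω = 2 → L(2)`.
 * `a ≥ 4`: **`L(a)` is FALSE**: `ω(1,a,a) ≤ 2a + (1 − 4·0.1722) < 2a + 1 ≤ ⌊(a+2)²/4⌋ ≤ ω(T(K_{a+2}))`
   — the max-cut flattening of CVZ19 eq. (1.4) against Lotti–Romani subadditivity/homogeneity through
   Coppersmith's point `ω(1, 0.1722, 1) = 2` (`book_lt_clique`, `not_cliqueRung_of_four_le`); for `a ≥ 6`
   even `ω(1,a,a) = 2a` exactly (`omegaRect_one_eq_two_mul_of_six_le`).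
 * `a = 3`: `6 ≤ ω(T(K₅))` and `6 ≤ ω(1,3,3) ≤ 6.4834`; `L(3)` would give `τ(T(K₅)) < 2/3`, i.e. settle
   the question BCKLOSW26 Rem. 21 leaves open («whether there is a `d` such that `τ(d) < 2/3`»), and under
   `ω = 2` it reads `ω(T(K₅)) = 6` (CVZ19 Problem 1.2.1 at `k = 5`) — so `L(3)` is NOT certified necessary
   for `ω = 2` and is not a cut piece; it is recorded as the UNDECIDED rung.
 * THE LADDER SET `{a | L(a)}` is one of `{0,1}`, `{0,1,2}`, `{0,1,3}`, `{0,1,2,3}` (`cliqueRung_subset`,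
   `zero_mem`, `one_mem`, `two_mem_iff`).

WHY IT MATTERS FOR THE LEAF (tags). The principle «true-twin internal edges are free relative to the
false-twin blow-up» is TRUE trivially at `a ≤ 1`, is the crux at `a = 2`, and is REFUTED by counting
alone at `a ≥ 4` (internal edges `binom(a,2)` grow quadratically, the book price `2a` linearly; max-cut of
`K_{a+2}` exceeds the grouping bound `2a` by `⌊a²/4⌋ − a ≥ 0` with equality only at `a ≤ 3`… strictly
for `a ≥ 5`, and at `a = 4` the book is already `< 9`). Hence NO ARGUMENT UNIFORM IN THE TWIN-CLIQUE SIZE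
`a` can prove the leaf: an admissible idea for 26697 must use the `a = 2` coincidence «max-cut(K₄) =
grouping bound = 4» (BARRIER tag for the idea class «uniform twin absorption», certificate
`not_forall_cliqueRung`). Leaf tags unchanged: NEC · WEAKER · ATTACKED · IDEA-NEEDED.
-/

noncomputable section

set_option linter.dupNamespace false

open Literature.Computability.AlgebraicComplexity
open Summit.MatrixMultiplication.MatrixMultiplication.Theorems.TetrahedronTensor

namespace Summit.MatrixMultiplication.MatrixMultiplication.Theorems.TetraTwinCliqueLadder

/-! ## §1 The book side `ω(1, a, a)`: information bound `2a`, and `≤ 2a + (1 − 4·0.1722)` for `a ≥ 4` -/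

section Book

variable (F : Type) [Field F]

/-- Information bound: `2a ≤ ω(1, a, a)`. [cite: HuangPan1998, §2 eq. (2.8)] -/
theorem two_mul_le_omegaRect_one (a : ℝ) : 2 * a ≤ omegaRect F 1 a a := by
  have h := add_le_omegaRect₂₃ F 1 a a
  linarith

/-- Coppersmith's point in the first slot: `ω(0.1722, 1, 1) = 2`. [cite: Coppersmith1982, Thm. 1] -/
theorem omegaRect_coppersmith_one_one : omegaRect F 0.1722 1 1 = 2 := by
  rw [omegaRect_swap₁₂]
  exact omegaRect_eq_two_of_le_dualExponentAlpha F (coppersmith1982_dualExponentAlpha_gt F).le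

/-- Homogeneous form: `ω(0.1722·ν, ν, ν) = 2ν` for `ν ≥ 0` (Lotti–Romani homogeneity).
[cite: LottiRomani1983, §1 (p. 173)] -/
theorem omegaRect_coppersmith_smul {ν : ℝ} (hν : 0 ≤ ν) : omegaRect F (ν * 0.1722) ν ν = 2 * ν := by
  have h := LottiRomani1983_homogeneous F hν (by norm_num : (0 : ℝ) ≤ 0.1722) zero_le_one zero_le_one
  rw [mul_one, omegaRect_coppersmith_one_one] at h
  rw [h, mul_comm]

/-- **`ω(1, a, a) ≤ 2a + 0.3112` for every real `a ≥ 4`**: `(1, a, a) = (4·0.1722, 4, 4) + (0.3112, a−4, a−4)`,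
subadditivity, `ω(4·0.1722, 4, 4) = 8` and the standard algorithm `ω(0.3112, a−4, a−4) ≤ 0.3112 + 2(a−4)`.
[cite: LottiRomani1983, §1 (p. 173)] [cite: Coppersmith1982, Thm. 1] -/
theorem omegaRect_one_le_of_four_le {a : ℝ} (ha : 4 ≤ a) : omegaRect F 1 a a ≤ 2 * a + 0.3112 := by
  have hsub := LottiRomani1983_subadditive F (4 * 0.1722) 4 4 0.3112 (a - 4) (a - 4)
  have e1 : (4 : ℝ) * 0.1722 + 0.3112 = 1 := by norm_num
  have e2 : (4 : ℝ) + (a - 4) = a := by ring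
  rw [e1, e2, omegaRect_coppersmith_smul F (by norm_num : (0 : ℝ) ≤ 4)] at hsub
  have hmax := omegaRect_le_max F (rectAdmissibleExponents_bddBelow F 0.3112 (a - 4) (a - 4))
  have m1 : max (0.3112 : ℝ) 0 = 0.3112 := max_eq_left (by norm_num)
  have m2 : max (a - 4) 0 = a - 4 := max_eq_left (by linarith)
  rw [m1, m2] at hmax
  linarith

/-- **`ω(1, a, a) < 2a + 1` for `a ≥ 4`.** [cite: LottiRomani1983, §1 (p. 173)] [cite: Coppersmith1982, Thm. 1] -/
theorem omegaRect_one_lt_of_four_le {a : ℝ} (ha : 4 ≤ a) : omegaRect F 1 a a < 2 * a + 1 := by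
  have h := omegaRect_one_le_of_four_le F ha
  linarith

/-- **`ω(1, a, a) = 2a` exactly for `a ≥ 6`** (`6·0.1722 > 1`: `(1, a, a) ≤ (q·0.1722, q, q) + (0, a−q, a−q)`
with `q = 1/0.1722`, so `ω(1,a,a) ≤ 2q + 2(a − q) = 2a`; and `2a` is the information bound).
[cite: LottiRomani1983, §1 (p. 173)] [cite: Coppersmith1982, Thm. 1] -/
theorem omegaRect_one_eq_two_mul_of_six_le {a : ℝ} (ha : 6 ≤ a) : omegaRect F 1 a a = 2 * a := by
  refine le_antisymm ?_ (two_mul_le_omegaRect_one F a)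
  set q : ℝ := 1 / 0.1722 with hq
  have hq0 : 0 ≤ q := by rw [hq]; norm_num
  have hq6 : q ≤ 6 := by rw [hq]; norm_num
  have hsub := LottiRomani1983_subadditive F (q * 0.1722) q q 0 (a - q) (a - q)
  have e1 : q * 0.1722 + 0 = 1 := by rw [hq]; norm_num
  have e2 : q + (a - q) = a := by ring
  rw [e1, e2, omegaRect_coppersmith_smul F hq0,
    omegaRect_eq_add_of_nonpos₁ F le_rfl (by linarith) (by linarith)] at hsub
  linarith

/-- `ω(1, 3, 3) ≤ 6.4834` (`(1,3,3) = (3·0.1722, 3, 3) + (0.4834, 0, 0)`). [cite: Coppersmith1982, Thm. 1] -/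
theorem omegaRect_one_three_three_le : omegaRect F 1 3 3 ≤ 6.4834 := by
  have hsub := LottiRomani1983_subadditive F (3 * 0.1722) 3 3 0.4834 0 0
  have e1 : (3 : ℝ) * 0.1722 + 0.4834 = 1 := by norm_num
  rw [e1, add_zero, omegaRect_coppersmith_smul F (by norm_num : (0 : ℝ) ≤ 3),
    omegaRect_eq_add_of_nonpos₃ F (by norm_num) le_rfl le_rfl] at hsub
  linarith

/-- `6 ≤ ω(1, 3, 3)`. [cite: HuangPan1998, §2 eq. (2.8)] -/
theorem six_le_omegaRect_one_three_three : 6 ≤ omegaRect F 1 3 3 := by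
  have h := two_mul_le_omegaRect_one F 3
  linarith

/-- `ω(1, 0, 0) = 1`. [cite: HuangPan1998, §2 eq. (2.4)] -/
theorem omegaRect_one_zero_zero : omegaRect F 1 0 0 = 1 := by
  rw [omegaRect_eq_add_of_nonpos₃ F zero_le_one le_rfl le_rfl, add_zero]

/-- `ω(1, 2, 2) = ω(2, 1, 2)` (the route states the diamond exponent as `ω(2,1,2)`).
[cite: AlmanDuanVassilevskaWilliamsXuXuZhou2025, §3.4] -/
theorem omegaRect_one_two_two_eq : omegaRect F 1 2 2 = omegaRect F 2 1 2 :=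
  omegaRect_swap₁₂ F 1 2 2

end Book

/-! ## §2 The clique side `ω(T(K_{a+2}))`: max-cut floor `⌊(a+2)²/4⌋`, small cliques, clique covers -/

section Clique

variable (F : Type) [Field F]

/-- Max-cut flattening: `⌊(a+2)²/4⌋ ≤ ω(T(K_{a+2}))`. [cite: ChristandlVranaZuiddam2016, §1.2 (eq. (1.4))] -/
theorem maxcut_le_graphOmega_clique (a : ℕ) :
    (((a + 2) ^ 2 / 4 : ℕ) : ℝ) ≤ graphOmega F (cliqueSlots (a + 1)) := by
  have h := sq_div_four_le_graphOmega_cliqueSlots F (a + 1)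
  exact h

/-- The arithmetic of the refutation: `2a + 1 ≤ ⌊(a+2)²/4⌋` for `a ≥ 4` (`⌊(a+2)²/4⌋ = ⌊a²/4⌋ + a + 1`
and `⌊a²/4⌋ ≥ a` iff `a ≥ 4`). [cite: ChristandlVranaZuiddam2016, §1.2 (eq. (1.4))] -/
theorem two_mul_add_one_le_maxcut {a : ℕ} (ha : 4 ≤ a) : 2 * a + 1 ≤ (a + 2) ^ 2 / 4 := by
  rw [Nat.le_div_iff_mul_le (by norm_num : 0 < 4)]
  nlinarith

/-- `ω(T(K₂)) = 1` (a single EPR edge: flattening and the trivial cover agree).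
[cite: ChristandlVranaZuiddam2016, §1.2 (table)] -/
theorem graphOmega_cliqueSlots_one : graphOmega F (cliqueSlots 1) = 1 := by
  refine le_antisymm ?_ ?_
  · have h := graphOmega_cliqueSlots_le F 1
    have e : ((1 + 1).choose 2 : ℕ) = 1 := by decide
    rw [e] at h
    exact_mod_cast h
  · have h := sq_div_four_le_graphOmega_cliqueSlots F 1
    have e : ((1 + 1) ^ 2 / 4 : ℕ) = 1 := by decide
    rw [e] at h
    exact_mod_cast h

/-- `ω(T(K₃)) = ω(1,1,1)`. [cite: ChristandlVranaZuiddam2016, Ex. 1.1.2] -/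
theorem graphOmega_cliqueSlots_two_eq : graphOmega F (cliqueSlots 2) = omegaRect F 1 1 1 := by
  rw [graphOmega_cliqueSlots_two, omegaRect_one_one_one]

/-- `ω(T(K₄)) = omegaTetra` (the tree's tetrahedron exponent, either presentation).
[cite: ChristandlVranaZuiddam2016, Def. 1.1.25] -/
theorem graphOmega_cliqueSlots_three_eq : graphOmega F (cliqueSlots 3) = omegaTetra F :=
  (omegaTetra_eq_graphOmega_cliqueSlots F).symm

/-- `6 ≤ ω(T(K₅))` (max-cut `⌊25/4⌋ = 6`). [cite: ChristandlVranaZuiddam2016, §1.2 (eq. (1.4))] -/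
theorem six_le_graphOmega_cliqueSlots_four : 6 ≤ graphOmega F (cliqueSlots 4) := by
  have h := maxcut_le_graphOmega_clique F 3
  have e : ((3 + 2) ^ 2 / 4 : ℕ) = 6 := by decide
  rw [e] at h
  exact_mod_cast h

/-- `9 ≤ ω(T(K₆))` (max-cut `36/4 = 9`). [cite: ChristandlVranaZuiddam2016, §1.2 (eq. (1.4))] -/
theorem nine_le_graphOmega_cliqueSlots_five : 9 ≤ graphOmega F (cliqueSlots 5) := by
  have h := maxcut_le_graphOmega_clique F 4
  have e : ((4 + 2) ^ 2 / 4 : ℕ) = 9 := by decide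
  rw [e] at h
  exact_mod_cast h

/-- `τ(T(K₅)) = ω(T(K₅))/10`. [cite: ChristandlVranaZuiddam2016, Def. 1.1.25] -/
theorem graphTau_cliqueSlots_four : graphTau F (cliqueSlots 4) = graphOmega F (cliqueSlots 4) / 10 := by
  unfold graphTau
  rw [card_cliqueEdge]
  norm_num [Nat.choose]

/-- Clique covers (CVZ19 Prop. 1.1.26, proved in the tree): `ω(T(K_{a+2})) ≤ binom(a+2, 2)·ω(T(K₄))/6`
for `a ≥ 2` — so under the leaf `ω(T(K_{a+2})) ≤ binom(a+2,2)·ω(2,1,2)/6`.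
[cite: ChristandlVranaZuiddam2016, Prop. 1.1.26] -/
theorem graphOmega_clique_le_choose_mul_omegaTetra {a : ℕ} (ha : 2 ≤ a) :
    graphOmega F (cliqueSlots (a + 1)) ≤ ((a + 2).choose 2 : ℕ) * omegaTetra F / 6 := by
  have h := graphTau_cliqueSlots_antitone F (d₁ := a + 1) (d₂ := 3) (by norm_num) (by omega)
  rw [graphTau_cliqueSlots_three, ← omegaTetra_eq_graphOmega] at h
  unfold graphTau at h
  have e : ((a + 1 + 1).choose 2 : ℕ) = (a + 2).choose 2 := rfl
  rw [card_cliqueEdge, e] at h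
  have hpos : (0 : ℝ) < ((a + 2).choose 2 : ℕ) := by
    have : 0 < (a + 2).choose 2 := Nat.choose_pos (by omega)
    exact_mod_cast this
  rw [div_le_iff₀ hpos] at h
  rw [le_div_iff₀ (by norm_num : (0 : ℝ) < 6)]
  linarith

end Clique

/-! ## §3 The ladder `L(a) : ω(T(K_{a+2})) ≤ ω(1, a, a)` rung by rung -/

section Ladder

variable (F : Type) [Field F]

/-- **Rung `a = 0` holds with equality**: `ω(T(K₂)) = 1 = ω(1, 0, 0)`. [cite: ChristandlVranaZuiddam2016, §1.2 (table)] -/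
theorem cliqueRung_zero : graphOmega F (cliqueSlots 1) ≤ omegaRect F 1 0 0 := by
  rw [graphOmega_cliqueSlots_one, omegaRect_one_zero_zero]

/-- **Rung `a = 1` holds with equality**: `ω(T(K₃)) = ω = ω(1, 1, 1)`. [cite: ChristandlVranaZuiddam2016, Ex. 1.1.2] -/
theorem cliqueRung_one : graphOmega F (cliqueSlots 2) ≤ omegaRect F 1 1 1 :=
  (graphOmega_cliqueSlots_two_eq F).le

/-- **Rung `a = 2` IS the attacked leaf's inequality**: `ω(T(K₄)) ≤ ω(1,2,2) ↔ omegaTetra ≤ ω(2,1,2)`.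
[cite: ChristandlVranaZuiddam2016, Problem 1.2.1] -/
theorem cliqueRung_two_iff :
    graphOmega F (cliqueSlots 3) ≤ omegaRect F 1 2 2 ↔ omegaTetra F ≤ omegaRect F 2 1 2 := by
  rw [graphOmega_cliqueSlots_three_eq, omegaRect_one_two_two_eq]

/-- At `F = ℂ`: **rung `a = 2` ↔ `TetraExcessZero`** (item stmt-MatrixMultiplication-26697, by name).
[cite: ChristandlVranaZuiddam2016, Problem 1.2.1] -/
theorem cliqueRung_two_iff_tetraExcessZero :
    graphOmega ℂ (cliqueSlots 3) ≤ omegaRect ℂ 1 2 2 ↔ Theses.TetrahedronCarving.TetraExcessZero := by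
  rw [cliqueRung_two_iff]
  exact Iff.rfl

/-- The excess at `a = 2` is non-negative: `ω(1,2,2) ≤ ω(T(K₄))` (grouping the twins, tree theorem
`omegaRect_two_one_two_le_omegaTetra`). [cite: ChristandlVranaZuiddam2016, §1.2] -/
theorem omegaRect_one_two_two_le_graphOmega : omegaRect F 1 2 2 ≤ graphOmega F (cliqueSlots 3) := by
  rw [graphOmega_cliqueSlots_three_eq, omegaRect_one_two_two_eq]
  exact omegaRect_two_one_two_le_omegaTetra F

/-- So rung `a = 2` is an EQUALITY claim `ω(T(K₄)) = ω(1,2,2)`. [cite: ChristandlVranaZuiddam2016, Problem 1.2.1] -/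
theorem cliqueRung_two_iff_eq :
    graphOmega F (cliqueSlots 3) ≤ omegaRect F 1 2 2 ↔ graphOmega F (cliqueSlots 3) = omegaRect F 1 2 2 :=
  ⟨fun h => le_antisymm h (omegaRect_one_two_two_le_graphOmega F), fun h => h.le⟩

/-- **Rungs `a ≥ 4` are FALSE: the book is strictly cheaper than the clique**,
`ω(1, a, a) < 2a + 1 ≤ ⌊(a+2)²/4⌋ ≤ ω(T(K_{a+2}))`, over every field.
[cite: ChristandlVranaZuiddam2016, §1.2 (eq. (1.4))] [cite: Coppersmith1982, Thm. 1] -/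
theorem book_lt_clique {a : ℕ} (ha : 4 ≤ a) :
    omegaRect F 1 a a < graphOmega F (cliqueSlots (a + 1)) := by
  have ha' : (4 : ℝ) ≤ a := by exact_mod_cast ha
  have h1 := omegaRect_one_lt_of_four_le F ha'
  have h2 : ((2 * a + 1 : ℕ) : ℝ) ≤ (((a + 2) ^ 2 / 4 : ℕ) : ℝ) := by
    exact_mod_cast two_mul_add_one_le_maxcut ha
  have h3 := maxcut_le_graphOmega_clique F a
  push_cast at h2
  linarith

/-- **`¬ L(a)` for every `a ≥ 4`.** [cite: ChristandlVranaZuiddam2016, §1.2 (eq. (1.4))] [cite: Coppersmith1982, Thm. 1] -/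
theorem not_cliqueRung_of_four_le {a : ℕ} (ha : 4 ≤ a) :
    ¬ graphOmega F (cliqueSlots (a + 1)) ≤ omegaRect F 1 a a :=
  not_le.mpr (book_lt_clique F ha)

/-- The first refuted rung in numbers: `ω(1,4,4) ≤ 8.3112 < 9 ≤ ω(T(K₆))`.
[cite: ChristandlVranaZuiddam2016, §1.2 (eq. (1.4))] [cite: Coppersmith1982, Thm. 1] -/
theorem rung_four_numbers : omegaRect F 1 4 4 ≤ 8.3112 ∧ 9 ≤ graphOmega F (cliqueSlots 5) := by
  refine ⟨?_, nine_le_graphOmega_cliqueSlots_five F⟩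
  have h := omegaRect_one_le_of_four_le F (le_refl (4 : ℝ))
  linarith

/-- **The uniform principle is dead**: «for every `a ≥ 1`, the clique `K_{a+2}` is no dearer than the book
`K_{1,1,a}`» is false (witness `a = 4`). Any proof of the `a = 2` rung (the leaf) must therefore use a
feature of `a = 2` absent at `a = 4`. [cite: ChristandlVranaZuiddam2016, §1.2 (eq. (1.4))] -/
theorem not_forall_cliqueRung :
    ¬ ∀ a : ℕ, 1 ≤ a → graphOmega F (cliqueSlots (a + 1)) ≤ omegaRect F 1 a a :=
  fun h => not_cliqueRung_of_four_le F (le_refl 4) (h 4 (by norm_num))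

/-- **The ladder set is contained in `{0, 1, 2, 3}`.** [cite: ChristandlVranaZuiddam2016, §1.2 (eq. (1.4))] -/
theorem cliqueRung_subset :
    {a : ℕ | graphOmega F (cliqueSlots (a + 1)) ≤ omegaRect F 1 a a} ⊆ ({0, 1, 2, 3} : Set ℕ) := by
  intro a ha
  by_contra hnot
  have h4 : 4 ≤ a := by
    simp only [Set.mem_insert_iff, Set.mem_singleton_iff] at hnot
    omega
  exact not_cliqueRung_of_four_le F h4 ha

/-- `0` and `1` are in the ladder set. [cite: ChristandlVranaZuiddam2016, §1.2 (table)] -/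
theorem zero_one_subset_cliqueRung :
    ({0, 1} : Set ℕ) ⊆ {a : ℕ | graphOmega F (cliqueSlots (a + 1)) ≤ omegaRect F 1 a a} := by
  intro a ha
  simp only [Set.mem_insert_iff, Set.mem_singleton_iff] at ha
  rcases ha with rfl | rfl
  · simpa using cliqueRung_zero F
  · simpa using cliqueRung_one F

/-- `2` is in the ladder set iff the leaf's inequality holds. [cite: ChristandlVranaZuiddam2016, Problem 1.2.1] -/
theorem two_mem_cliqueRung_iff :
    (2 : ℕ) ∈ {a : ℕ | graphOmega F (cliqueSlots (a + 1)) ≤ omegaRect F 1 a a} ↔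
      omegaTetra F ≤ omegaRect F 2 1 2 := by
  rw [Set.mem_setOf_eq, ← cliqueRung_two_iff F]
  norm_num

/-! ### Rung `a = 3` (`K₅`): undecided, not necessary-certified, harder than a printed open question -/

/-- The `a = 3` sandwich: `6 ≤ ω(T(K₅))`, `6 ≤ ω(1,3,3) ≤ 6.4834` — neither side decides `L(3)`.
[cite: ChristandlVranaZuiddam2016, Problem 1.2.1] [cite: Coppersmith1982, Thm. 1] -/
theorem rung_three_sandwich :
    6 ≤ graphOmega F (cliqueSlots 4) ∧ 6 ≤ omegaRect F 1 3 3 ∧ omegaRect F 1 3 3 ≤ 6.4834 :=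
  ⟨six_le_graphOmega_cliqueSlots_four F, six_le_omegaRect_one_three_three F,
    omegaRect_one_three_three_le F⟩

/-- **`L(3)` would answer BCKLOSW26's open question** («whether there is a `d` with `τ(d) < 2/3`»):
`ω(T(K₅)) ≤ ω(1,3,3) ≤ 6.4834 < 20/3` gives `τ(T(K₅)) < 2/3`. [cite: BrandEtAl2026, Remark 21] -/
theorem graphTau_cliqueSlots_four_lt_of_cliqueRung_three
    (h : graphOmega F (cliqueSlots 4) ≤ omegaRect F 1 3 3) : graphTau F (cliqueSlots 4) < 2 / 3 := by
  rw [graphTau_cliqueSlots_four]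
  have h' := omegaRect_one_three_three_le F
  rw [div_lt_div_iff₀ (by norm_num) (by norm_num)]
  linarith

end Ladder

/-! ## §4 Readings under the summit `ω = 2` (which rungs are NECESSARY) -/

section UnderSummit

/-- Under `ω = 2`: `ω(1, a, a) = 2a` for every real `a ≥ 1` (information bound met).
[cite: HuangPan1998, §2 eq. (2.5)–(2.8) (p. 261–262)] -/
theorem omegaRect_one_eq_two_mul_of_matrixMultiplication (hS : _root_.MatrixMultiplication) {a : ℝ}
    (ha : 1 ≤ a) : omegaRect ℂ 1 a a = 2 * a := by
  have hω : omega ℂ = 2 := (_root_.MatrixMultiplication_iff).1 hS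
  rw [omegaRect_eq_sub_min_of_omega_eq_two ℂ hω zero_le_one (by linarith) (by linarith),
    min_self, min_eq_left ha]
  ring

/-- **NEC of rung `a = 2`** (the leaf): `ω = 2 → ω(T(K₄)) ≤ 4 ≤ ω(1,2,2)`.
[cite: ChristandlVranaZuiddam2016, §1.3] -/
theorem cliqueRung_two_of_matrixMultiplication (hS : _root_.MatrixMultiplication) :
    graphOmega ℂ (cliqueSlots 3) ≤ omegaRect ℂ 1 2 2 := by
  rw [graphOmega_cliqueSlots_three_eq]
  have h1 := omegaTetra_le_four_of_matrixMultiplication hS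
  have h2 := two_mul_le_omegaRect_one ℂ 2
  linarith

/-- **Rung `a = 3` under `ω = 2` reads `ω(T(K₅)) = 6`**, i.e. `τ(T(K₅)) = 3/5` — CVZ19 Problem 1.2.1 at
`k = 5`, open in print even conditionally on `ω = 2` (BCKLOSW26 Rem. 21: `ω = 2` is only known to give
`τ(3) = τ(4) = 2/3`). So `L(3)` is NOT certified necessary and is not admissible as a cut piece.
[cite: ChristandlVranaZuiddam2016, Problem 1.2.1] [cite: BrandEtAl2026, Remark 21] -/
theorem cliqueRung_three_iff_of_matrixMultiplication (hS : _root_.MatrixMultiplication) :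
    graphOmega ℂ (cliqueSlots 4) ≤ omegaRect ℂ 1 3 3 ↔ graphOmega ℂ (cliqueSlots 4) = 6 := by
  rw [omegaRect_one_eq_two_mul_of_matrixMultiplication hS (by norm_num : (1 : ℝ) ≤ 3)]
  have h6 := six_le_graphOmega_cliqueSlots_four ℂ
  constructor
  · intro h; linarith [le_antisymm h (by linarith)]
  · intro h; linarith

end UnderSummit

/-! ## §5 The node's reading, by name -/

/-- **THE LADDER THEOREM (summary).** Over every field: rungs `0, 1` hold; rung `2` is the inequality of
the attacked leaf (`↔ TetraExcessZero` at `ℂ`); every rung `a ≥ 4` fails; so `{a | L(a)} ∈ {{0,1},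
{0,1,2}, {0,1,3}, {0,1,2,3}}`. [cite: ChristandlVranaZuiddam2016, §1.2 (eq. (1.4))] [cite: Coppersmith1982, Thm. 1] -/
theorem ladder (F : Type) [Field F] :
    ({0, 1} : Set ℕ) ⊆ {a : ℕ | graphOmega F (cliqueSlots (a + 1)) ≤ omegaRect F 1 a a} ∧
    {a : ℕ | graphOmega F (cliqueSlots (a + 1)) ≤ omegaRect F 1 a a} ⊆ ({0, 1, 2, 3} : Set ℕ) ∧
    ((2 : ℕ) ∈ {a : ℕ | graphOmega F (cliqueSlots (a + 1)) ≤ omegaRect F 1 a a} ↔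
      omegaTetra F ≤ omegaRect F 2 1 2) :=
  ⟨zero_one_subset_cliqueRung F, cliqueRung_subset F, two_mem_cliqueRung_iff F⟩

/-- At `ℂ`, with the leaf by name: `2 ∈ {a | L(a)} ↔ TetraExcessZero`, and `4 ∉ {a | L(a)}`.
[cite: ChristandlVranaZuiddam2016, Problem 1.2.1] -/
theorem ladder_complex :
    ((2 : ℕ) ∈ {a : ℕ | graphOmega ℂ (cliqueSlots (a + 1)) ≤ omegaRect ℂ 1 a a} ↔
      Theses.TetrahedronCarving.TetraExcessZero) ∧
    (4 : ℕ) ∉ {a : ℕ | graphOmega ℂ (cliqueSlots (a + 1)) ≤ omegaRect ℂ 1 a a} :=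
  ⟨(two_mem_cliqueRung_iff ℂ).trans Iff.rfl, fun h => not_cliqueRung_of_four_le ℂ le_rfl h⟩

end Summit.MatrixMultiplication.MatrixMultiplication.Theorems.TetraTwinCliqueLadder

end
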